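import Mathlib
import Summits.Ventures.PercRepro2.TB14CutCase1

/-!
# Side counts as all-free counts on the side's own edge type
(blind cell PercRepro2, mine-c g15, 2026-08-25; `proofs/MINEC-TB14BLOCK.md` §5, the block induction)

The side count `pairCount (sideFree S univ) (restrict S false) Φ` of an all-free instance is the
all-free two-copy count of the graph on the edge type `{e // e ∈ S}` (`ends ∘ Subtype.val`):
a configuration of the side extends by closing the other edges (`extend`), connections agree
(`conn_extend_iff`), and the admissible configurations of the side profile are exactly the
extensions (`pairCount_side_eq_subtype`).  This is what lets the cut-vertex theorems be applied
inductively on the number of edges.  Own work; standard axioms.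
-/

namespace Summit.Ventures.PercRepro2

namespace TB14Cut

open CovForm A3InactiveTyped

section Extend

variable {V : Type*} {E : Type*} (S : Set E) [DecidablePred (· ∈ S)]

/-- Extend a configuration of the side `S` by closing every other edge. -/
def extend (u : Config {e // e ∈ S}) : Config E := fun e => if h : e ∈ S then u ⟨e, h⟩ else false

/-- `extend` on an edge of the side. -/
lemma extend_of_mem (u : Config {e // e ∈ S}) {e : E} (h : e ∈ S) : extend S u e = u ⟨e, h⟩ :=
  dif_pos h

/-- `extend` off the side. -/
lemma extend_of_notMem (u : Config {e // e ∈ S}) {e : E} (h : e ∉ S) : extend S u e = false :=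
  dif_neg h

/-- The side's own graph. -/
def sideEnds (ends : E → Sym2 V) : {e // e ∈ S} → Sym2 V := fun e => ends e.1

/-- **Connections transfer**: `x ↔ y` in the extension iff `x ↔ y` in the side's own graph. -/
lemma conn_extend_iff (ends : E → Sym2 V) (u : Config {e // e ∈ S}) (x y : V) :
    Conn ends (extend S u) x y ↔ Conn (sideEnds S ends) u x y := by
  constructor
  · intro h
    refine mem_of_conn_of_closed (S := {w | Conn (sideEnds S ends) u x w}) ?_
      (conn_refl _ _ x) h
    intro a ha w haw
    obtain ⟨_, e, he, hends⟩ := openGraph_adj.1 haw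
    have heS : e ∈ S := by
      by_contra hcon
      rw [extend_of_notMem S u hcon] at he
      exact Bool.false_ne_true he
    rw [extend_of_mem S u heS] at he
    exact conn_trans ha (conn_of_openAdj ⟨⟨e, heS⟩, he, hends⟩)
  · intro h
    refine mem_of_conn_of_closed (S := {w | Conn ends (extend S u) x w}) ?_
      (conn_refl _ _ x) h
    intro a ha w haw
    obtain ⟨_, e, he, hends⟩ := openGraph_adj.1 haw
    refine conn_trans ha (conn_of_openAdj ⟨e.1, ?_, hends⟩)
    rw [extend_of_mem S u e.2]
    exact he

variable {R : Type*} [Field R]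

/-- The connection indicators transfer. -/
lemma iL_extend (ends : E → Sym2 V) (u : Config {e // e ∈ S}) (a v : V) :
    (iL ends a v (extend S u) : R) = iL (sideEnds S ends) a v u := by
  classical
  rw [iL_eq_ite', iL_eq_ite', conn_extend_iff]

/-- The connection indicators transfer (`iH`). -/
lemma iH_extend (ends : E → Sym2 V) (u : Config {e // e ∈ S}) (a v : V) :
    (iH ends a v (extend S u) : R) = iH (sideEnds S ends) a v u := by
  classical
  rw [iH_eq_ite', iH_eq_ite', conn_extend_iff]

/-- The separation indicator transfers. -/
lemma iQ_extend (ends : E → Sym2 V) (u : Config {e // e ∈ S}) (a₁ a₂ : V) :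
    (iQ ends a₁ a₂ (extend S u) : R) = iQ (sideEnds S ends) a₁ a₂ u := by
  classical
  rw [iQ_eq_ite', iQ_eq_ite', conn_extend_iff]

/-- The «same» kernel transfers. -/
lemma sameBO_extend (ends : E → Sym2 V) (u w : Config {e // e ∈ S}) (a₁ a₂ b o : V) :
    (sameBO ends a₁ a₂ b o (extend S u) (extend S w) : R) =
      sameBO (sideEnds S ends) a₁ a₂ b o u w := by
  simp only [sameBO, iQ_extend, iL_extend, iH_extend]

/-- The «cross» kernel transfers. -/
lemma crossBO_extend (ends : E → Sym2 V) (u w : Config {e // e ∈ S}) (a₁ a₂ b o : V) :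
    (crossBO ends a₁ a₂ b o (extend S u) (extend S w) : R) =
      crossBO (sideEnds S ends) a₁ a₂ b o u w := by
  simp only [crossBO, iQ_extend, iL_extend, iH_extend]

end Extend

section Count

variable {E : Type*} [Fintype E] [DecidableEq E] (S : Set E) [DecidablePred (· ∈ S)]
  {R : Type*} [CommRing R]

/-- The restriction of a configuration to the side. -/
def toSide (y : Config E) : Config {e // e ∈ S} := fun e => y e.1

omit [Fintype E] [DecidableEq E] in
/-- `extend` after `toSide` on an admissible (closed off `S`) configuration. -/
lemma extend_toSide {y : Config E} (hy : ∀ e, e ∉ S → y e = false) : extend S (toSide S y) = y := by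
  funext e
  by_cases h : e ∈ S
  · rw [extend_of_mem S _ h]
    rfl
  · rw [extend_of_notMem S _ h, hy e h]

omit [Fintype E] [DecidableEq E] in
/-- `toSide` after `extend`. -/
lemma toSide_extend (u : Config {e // e ∈ S}) : toSide S (extend S u) = u := by
  funext e
  simp only [toSide]
  rw [extend_of_mem S u e.2]

/-- The second copy of an extension is the extension of the second copy. -/
lemma flipOn_extend (u : Config {e // e ∈ S}) :
    A3InactiveTyped.flipOn (sideFree S Finset.univ) (extend S u) =
      extend S (A3InactiveTyped.flipOn Finset.univ u) := by
  funext e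
  by_cases h : e ∈ S
  · have h' : e ∈ sideFree S Finset.univ := mem_sideFree.2 ⟨Finset.mem_univ _, h⟩
    rw [A3InactiveTyped.flipOn_of_mem h', extend_of_mem S _ h, extend_of_mem S _ h,
      A3InactiveTyped.flipOn_of_mem (Finset.mem_univ _)]
  · have h' : e ∉ sideFree S Finset.univ := fun h' => h (mem_sideFree.1 h').2
    rw [A3InactiveTyped.flipOn_of_notMem h', extend_of_notMem S _ h, extend_of_notMem S _ h]

/-- **The side count is the all-free count of the side's own graph.** -/
theorem pairCount_side_eq_subtype (Φ : Config E → Config E → R) :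
    pairCount (sideFree S Finset.univ) (restrict S (fun _ => false)) Φ =
      pairCount (Finset.univ : Finset {e // e ∈ S}) (fun _ => false)
        (fun u w => Φ (extend S u) (extend S w)) := by
  unfold pairCount
  have hadm : ∀ u : Config {e // e ∈ S}, (∀ e, e ∉ (Finset.univ : Finset {e // e ∈ S}) →
      u e = false) := fun u e he => absurd (Finset.mem_univ e) he
  rw [← Finset.sum_filter]
  symm
  refine Finset.sum_nbij' (fun u => extend S u) (fun y => toSide S y) ?_ ?_ ?_ ?_ ?_
  · intro u _
    rw [Finset.mem_filter]
    refine ⟨Finset.mem_univ _, fun e he => ?_⟩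
    have h : e ∉ S := fun h => he (mem_sideFree.2 ⟨Finset.mem_univ _, h⟩)
    rw [extend_of_notMem S u h, restrict_apply_of_notMem h]
  · intro y _
    exact Finset.mem_univ _
  · intro u _
    exact toSide_extend S u
  · intro y hy
    have hy' := (Finset.mem_filter.1 hy).2
    refine extend_toSide S fun e he => ?_
    have h : e ∉ sideFree S Finset.univ := fun h => he (mem_sideFree.1 h).2
    rw [hy' e h, restrict_apply_of_notMem he]
  · intro u _
    rw [if_pos (hadm u), flipOn_extend]

end Count

end TB14Cut

end Summit.Ventures.PercRepro2
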